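/-
Copyright (c) 2026. All rights reserved.
Released under Apache 2.0 license as described in the file LICENSE.
Authors: abc-iut cell, seat abc-iut-L4-t8 (gen 9; PROOF-ONLY sequel of `ArchimedeanHolGroupPairs`: the recorded
fields `surj`, `hol` of a morphism of `𝒞^hol_{TH⊞}` are CONSEQUENCES of the Kummer compatibility).
-/
import Literature.AnabelianGeometry.AbsoluteAnabelian.ArchimedeanHolGroupPairsTBPlusFunctor
import HarnessLib

/-!
# [AbsTopIII] Def 4.1 (ii), `T = TH⊞`: a Kummer-compatible homomorphism is automatically onto and Aut-holomorphic

S. Mochizuki, *Topics in absolute anabelian geometry III*, Def 4.1 (ii) p.102: a morphism of Aut-holomorphic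
`TH⊞`-pairs is «a morphism of objects `φ_M : M₁ → M₂` of `T`» (a homomorphism of Aut-holomorphic groups)
«together with a compatible [relative to the respective Kummer structures] finite étale morphism `φ_𝕏`».
The typed `HolTHPlusPair.Hom` (`ArchimedeanHolGroupPairs`, p486047) RECORDS two further fields — `surj`
(`φ_M` onto) and `hol` (`φ_M` a holomorphic local isomorphism in the Kummer charts) — which its review noted
to be derivable.  This PROOF-ONLY file derives them from the Kummer compatibility
`κ₂ ∘ φ_M = 𝒜_{φ_𝕏} ∘ κ₁` ALONE, so that the typed category is print's on the nose:

* `THPlusShape.eq_zero_of_univCover_eq_one` — an additive continuous `d : k → k′` between CAFs with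
  `exp_{k′} ∘ d = 1` vanishes (discreteness of `ker exp`, through real lines);
* CLASSIFICATION of compatible homomorphisms by shapes (`σ := c₂⁻¹ ∘ 𝒜_{φ_𝕏} ∘ c₁ : k₁ ⥲ k₂`): on presented
  data `φ_M` is `σ` (`presMap_eq_times_times`, `presMap_eq_sim_sim` — the latter by the discreteness of
  `ker exp`), `exp ∘ σ` (`presMap_eq_sim_times`), and `k^× → k∼` is IMPOSSIBLE (`false_of_times_sim`: a
  continuous logarithm homomorphism would give `(-1)² = 1 ⇒ -1 = exp 0 = 1`);
* ★ `HolTHPlusPair.surjective_of_compat`, ★ `HolTHPlusPair.isHolLocIso_of_compat` — `φ_M` is onto and a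
  holomorphic local isomorphism in the charts; so `⟨φ_𝕏, φ_M, surjective_of_compat …, compat,
  isHolLocIso_of_compat …⟩` is the morphism of `𝒞^hol_{TH⊞}` determined by `(φ_𝕏, φ_M, compat)` alone
  (`HolTHPlusPair.Hom.ofCompat_arith` records this).

Refereed pre-IUT material; classical; nothing here bears on [IUTchIII] Cor. 3.12; no side taken.
-/

set_option autoImplicit false

noncomputable section

namespace Literature.AnabelianGeometry.AbsoluteAnabelian

open _root_.CategoryTheory _root_.Topology _root_.Complex

universe u

namespace THPlusShape

variable {k k' : Type u} [NormedField k] [NormedField k']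

/-- **An additive continuous map `d : k → k′` between CAFs with `exp_{k′} ∘ d = 1` vanishes** (through each
real line `t ↦ e⁻¹(t·e(x))` it is an additive continuous `ℝ → ℂ` with `exp = 1`, `eq_zero_of_exp_eq_one`).
[cite: MochizukiAbsTopIII2015, Definition 4.1 (i) p.101] -/
theorem eq_zero_of_univCover_eq_one [CharZero k] [CharZero k'] (hk : IsCAF k) (hk' : IsCAF k')
    (d : k →+ k') (hd : Continuous d) (h : ∀ x, univCover k' (d x) = 1) (x : k) : d x = 0 := by
  obtain ⟨e, he, he'⟩ := hk.exists_equiv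
  obtain ⟨e', hE, hE'⟩ := hk'.exists_equiv
  let L : ℝ →+ k :=
    { toFun := fun t => e.symm ((t : ℂ) * e x)
      map_zero' := by rw [ofReal_zero, zero_mul, map_zero]
      map_add' := fun a b => by rw [ofReal_add, add_mul, map_add] }
  have hL : Continuous L := he'.comp (continuous_ofReal.mul continuous_const)
  let D : ℝ →+ ℂ := (e'.toAddMonoidHom.comp d).comp L
  have hD : Continuous D := hE.comp (hd.comp hL)
  have hexp : ∀ t, exp (D t) = 1 := by
    intro t
    have h1 := h (L t)
    rw [IsCAF.univCover_eq e' hE'] at h1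
    have h2 : e' (e'.symm (exp (e' (d (L t))))) = e' 1 := by rw [h1]
    rw [RingEquiv.apply_symm_apply, map_one] at h2
    exact h2
  have h0 := eq_zero_of_exp_eq_one D hD hexp 1
  change e' (d (e.symm (((1 : ℝ) : ℂ) * e x))) = 0 at h0
  rw [ofReal_one, one_mul, RingEquiv.symm_apply_apply] at h0
  exact (map_eq_zero_iff e' e'.injective).mp h0

/-- The shape's law preserves the carrier. [cite: MochizukiAbsTopIII2015, Definition 4.1 (i) p.101] -/
theorem op_mem (s : THPlusShape) {x y : k} (hx : x ∈ s.carrier k) (hy : y ∈ s.carrier k) :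
    s.op x y ∈ s.carrier k := by
  cases s
  · exact mul_ne_zero hx hy
  · exact Set.mem_univ _

end THPlusShape

/-! ### The classification of Kummer-compatible homomorphisms, case by case -/

section Classification

variable {k k' A A' B B' : Type u} [NormedField k] [NormedField k'] [NormedField A] [NormedField A']
  [AddCommGroup B] [TopologicalSpace B] [AddCommGroup B'] [TopologicalSpace B']
  (c : k ≃+* A) (c' : k' ≃+* A') (α : A ≃+* A') (φ : B →ₜ+ B')

/-- The presented map of a homomorphism compatible with the presentations is compatible with the laws.
[cite: MochizukiAbsTopIII2015, Definition 4.1 (ii) p.102] -/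
theorem presMap_op (s s' : THPlusShape) (pres : B ≃ₜ s.carrier k)
    (hadd : ∀ a b : B, ((pres (a + b) : s.carrier k) : k) = s.op (pres a : k) (pres b : k))
    (pres' : B' ≃ₜ s'.carrier k')
    (hadd' : ∀ a b : B', ((pres' (a + b) : s'.carrier k') : k') = s'.op (pres' a : k') (pres' b : k'))
    (x y : s.carrier k) :
    (pres' (φ (pres.symm ⟨s.op x y, THPlusShape.op_mem s x.2 y.2⟩)) : k') =
      s'.op (pres' (φ (pres.symm x)) : k') (pres' (φ (pres.symm y)) : k') := by
  have hxy : pres.symm ⟨s.op x y, THPlusShape.op_mem s x.2 y.2⟩ = pres.symm x + pres.symm y := by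
    apply pres.injective
    apply Subtype.ext
    rw [Homeomorph.apply_symm_apply, hadd, Homeomorph.apply_symm_apply, Homeomorph.apply_symm_apply]
  rw [hxy, map_add, hadd']

/-- `times → times`: `φ_M` on presented data is the field isomorphism `σ = c′⁻¹ ∘ α ∘ c`.
[cite: MochizukiAbsTopIII2015, Definition 4.1 (ii) p.102] -/
theorem presMap_eq_times_times [CharZero k] [CharZero k'] (pres : B ≃ₜ THPlusShape.times.carrier k)
    (pres' : B' ≃ₜ THPlusShape.times.carrier k')
    (hφ : ∀ b, THPlusShape.times.kummer c' (pres' (φ b) : k') = α (THPlusShape.times.kummer c (pres b : k)))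
    (x : THPlusShape.times.carrier k) : (pres' (φ (pres.symm x)) : k') = c'.symm (α (c x)) := by
  have h := hφ (pres.symm x)
  rw [Homeomorph.apply_symm_apply] at h
  change c' _ = α (c x) at h
  rw [← h, RingEquiv.symm_apply_apply]

/-- `sim → times`: `φ_M` on presented data is `exp ∘ σ`. [cite: MochizukiAbsTopIII2015, Definition 4.1 (ii) p.102] -/
theorem presMap_eq_sim_times [CharZero k] [CharZero k'] (hk : IsCAF k) (hc : Continuous c)
    (hα : Continuous α) (hc's : Continuous c'.symm) (pres : B ≃ₜ THPlusShape.sim.carrier k)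
    (pres' : B' ≃ₜ THPlusShape.times.carrier k')
    (hφ : ∀ b, THPlusShape.times.kummer c' (pres' (φ b) : k') = α (THPlusShape.sim.kummer c (pres b : k)))
    (x : THPlusShape.sim.carrier k) :
    (pres' (φ (pres.symm x)) : k') = univCover k' (c'.symm (α (c x))) := by
  let σ : k ≃+* k' := c.trans (α.trans c'.symm)
  have hσ : Continuous σ := hc's.comp (hα.comp hc)
  have h := hφ (pres.symm x)
  rw [Homeomorph.apply_symm_apply] at h
  change c' _ = α (c (univCover k (x : k))) at h
  have h2 : (pres' (φ (pres.symm x)) : k') = σ (univCover k (x : k)) := by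
    change _ = c'.symm (α (c _))
    rw [← h, RingEquiv.symm_apply_apply]
  rw [h2]
  exact IsCAF.map_univCover hk σ.toRingHom hσ (x : k)

/-- `times → sim` is IMPOSSIBLE: a homomorphism `g : k^× → (k′, +)` with `exp ∘ g = σ` would give
`g(1) = 0`, `2 g(-1) = g(1) = 0`, hence `σ(-1) = exp 0 = 1 = -1`. [cite: MochizukiAbsTopIII2015, Definition 4.1 (ii) p.102] -/
theorem false_of_times_sim [CharZero k] [CharZero k'] (hk' : IsCAF k') (pres : B ≃ₜ THPlusShape.times.carrier k)
    (hadd : ∀ a b : B, ((pres (a + b) : THPlusShape.times.carrier k) : k) =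
      THPlusShape.times.op (pres a : k) (pres b : k))
    (pres' : B' ≃ₜ THPlusShape.sim.carrier k')
    (hadd' : ∀ a b : B', ((pres' (a + b) : THPlusShape.sim.carrier k') : k') =
      THPlusShape.sim.op (pres' a : k') (pres' b : k'))
    (hφ : ∀ b, THPlusShape.sim.kummer c' (pres' (φ b) : k') = α (THPlusShape.times.kummer c (pres b : k))) :
    False := by
  let σ : k ≃+* k' := c.trans (α.trans c'.symm)
  have key : ∀ u : THPlusShape.times.carrier k, univCover k' (pres' (φ (pres.symm u)) : k') = σ u := by
    intro u
    have h := hφ (pres.symm u)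
    rw [Homeomorph.apply_symm_apply] at h
    change c' (univCover k' _) = α (c u) at h
    change _ = c'.symm (α (c u))
    rw [← h, RingEquiv.symm_apply_apply]
  have gop := presMap_op φ .times .sim pres hadd pres' hadd'
  let one' : THPlusShape.times.carrier k := ⟨1, one_ne_zero⟩
  let negOne : THPlusShape.times.carrier k := ⟨-1, neg_ne_zero.mpr one_ne_zero⟩
  have g1 : (pres' (φ (pres.symm one')) : k') = 0 := by
    have h := gop one' one'
    have e1 : (⟨THPlusShape.times.op (one' : k) (one' : k), THPlusShape.op_mem _ one'.2 one'.2⟩ :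
        THPlusShape.times.carrier k) = one' := Subtype.ext (mul_one (1 : k))
    rw [e1] at h
    change _ = (pres' (φ (pres.symm one')) : k') + (pres' (φ (pres.symm one')) : k') at h
    have h' := h.symm
    rwa [add_eq_left] at h'
  have gneg : (pres' (φ (pres.symm negOne)) : k') = 0 := by
    have h := gop negOne negOne
    have e1 : (⟨THPlusShape.times.op (negOne : k) (negOne : k), THPlusShape.op_mem _ negOne.2 negOne.2⟩ :
        THPlusShape.times.carrier k) = one' := Subtype.ext (by change (-1 : k) * (-1) = 1; ring)
    rw [e1, g1] at h
    change (0 : k') = (pres' (φ (pres.symm negOne)) : k') + (pres' (φ (pres.symm negOne)) : k') at h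
    have h2 : (2 : k') * (pres' (φ (pres.symm negOne)) : k') = 0 := by rw [two_mul]; exact h.symm
    exact (mul_eq_zero.mp h2).resolve_left two_ne_zero
  have hbad : σ negOne = 1 := by rw [← key negOne, gneg, IsCAF.univCover_zero hk']
  have hneg : σ (negOne : k) = -1 := by change σ (-1) = -1; rw [map_neg, map_one]
  rw [hneg] at hbad
  have h2 : (2 : k') = 0 := by
    have := congrArg (fun z : k' => z + 1) hbad
    simp only [neg_add_cancel] at this
    rw [show (2 : k') = 1 + 1 by norm_num]
    exact this.symm
  exact two_ne_zero h2

/-- `sim → sim`: `φ_M` on presented data is `σ` (the difference is additive, continuous, and killed by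
`exp_{k′}`, hence zero). [cite: MochizukiAbsTopIII2015, Definition 4.1 (ii) p.102] -/
theorem presMap_eq_sim_sim [CharZero k] [CharZero k'] (hk : IsCAF k) (hk' : IsCAF k') (hc : Continuous c)
    (hα : Continuous α) (hc's : Continuous c'.symm) (pres : B ≃ₜ THPlusShape.sim.carrier k)
    (hadd : ∀ a b : B, ((pres (a + b) : THPlusShape.sim.carrier k) : k) =
      THPlusShape.sim.op (pres a : k) (pres b : k))
    (pres' : B' ≃ₜ THPlusShape.sim.carrier k')
    (hadd' : ∀ a b : B', ((pres' (a + b) : THPlusShape.sim.carrier k') : k') =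
      THPlusShape.sim.op (pres' a : k') (pres' b : k'))
    (hφ : ∀ b, THPlusShape.sim.kummer c' (pres' (φ b) : k') = α (THPlusShape.sim.kummer c (pres b : k)))
    (x : THPlusShape.sim.carrier k) : (pres' (φ (pres.symm x)) : k') = c'.symm (α (c x)) := by
  let σ : k ≃+* k' := c.trans (α.trans c'.symm)
  have hσ : Continuous σ := hc's.comp (hα.comp hc)
  have key : ∀ y : THPlusShape.sim.carrier k,
      univCover k' (pres' (φ (pres.symm y)) : k') = univCover k' (σ y) := by
    intro y
    have h := hφ (pres.symm y)
    rw [Homeomorph.apply_symm_apply] at h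
    change c' (univCover k' _) = α (c (univCover k (y : k))) at h
    have h2 : univCover k' (pres' (φ (pres.symm y)) : k') = σ (univCover k (y : k)) := by
      change _ = c'.symm (α (c _))
      rw [← h, RingEquiv.symm_apply_apply]
    rw [h2]
    exact IsCAF.map_univCover hk σ.toRingHom hσ (y : k)
  have gop := presMap_op φ .sim .sim pres hadd pres' hadd'
  let emb : k → THPlusShape.sim.carrier k := fun y => ⟨y, Set.mem_univ y⟩
  have pres0 : (pres 0 : k) = 0 := by
    have := hadd 0 0
    rw [add_zero] at this
    change (pres 0 : k) = (pres 0 : k) + (pres 0 : k) at this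
    have h' := this.symm
    rwa [add_eq_left] at h'
  have pres0' : (pres' 0 : k') = 0 := by
    have := hadd' 0 0
    rw [add_zero] at this
    change (pres' 0 : k') = (pres' 0 : k') + (pres' 0 : k') at this
    have h' := this.symm
    rwa [add_eq_left] at h'
  let d : k →+ k' :=
    { toFun := fun y => (pres' (φ (pres.symm (emb y))) : k') - σ y
      map_zero' := by
        have h0 : pres.symm (emb 0) = 0 := by
          apply pres.injective
          apply Subtype.ext
          rw [Homeomorph.apply_symm_apply, pres0]
        rw [h0, map_zero φ, map_zero σ, sub_zero, pres0']
      map_add' := fun y z => by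
        have h := gop (emb y) (emb z)
        change (pres' (φ (pres.symm (emb (y + z)))) : k') =
          (pres' (φ (pres.symm (emb y))) : k') + (pres' (φ (pres.symm (emb z))) : k') at h
        rw [h, map_add]
        ring }
  have hdc : Continuous d := by
    change Continuous fun y => (pres' (φ (pres.symm (emb y))) : k') - σ y
    refine Continuous.sub ?_ hσ
    exact continuous_subtype_val.comp (pres'.continuous.comp (φ.continuous.comp
      (pres.symm.continuous.comp (continuous_id.subtype_mk _))))
  have hker : ∀ y, univCover k' (d y) = 1 := by
    intro y
    change univCover k' ((pres' (φ (pres.symm (emb y))) : k') - σ y) = 1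
    rw [sub_eq_add_neg, IsCAF.univCover_add hk', key (emb y)]
    change univCover k' (σ y) * univCover k' (-σ y) = 1
    rw [← IsCAF.univCover_add hk', add_neg_cancel, IsCAF.univCover_zero hk']
  have hx : emb (x : k) = x := Subtype.ext rfl
  have := THPlusShape.eq_zero_of_univCover_eq_one hk hk' d hdc hker (x : k)
  change (pres' (φ (pres.symm (emb x))) : k') - σ x = 0 at this
  rw [hx] at this
  exact sub_eq_zero.mp this

end Classification

/-! ### Onto and holomorphic, at the level of deconstructed pairs -/

section Aux

variable {k k' A A' B B' : Type u} [NormedField k] [NormedField k'] [NormedField A] [NormedField A']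
  [AddCommGroup B] [TopologicalSpace B] [AddCommGroup B'] [TopologicalSpace B']

/-- A Kummer-compatible continuous homomorphism is ONTO (all shapes). [cite: MochizukiAbsTopIII2015, Definition 4.1 (ii) p.102] -/
theorem surjective_of_compat_aux [CharZero k] [CharZero k'] (hk : IsCAF k) (hk' : IsCAF k')
    (s s' : THPlusShape) (c : k ≃+* A) (c' : k' ≃+* A') (α : A ≃+* A') (hc : Continuous c)
    (hα : Continuous α) (hc's : Continuous c'.symm) (pres : B ≃ₜ s.carrier k)
    (hadd : ∀ a b : B, ((pres (a + b) : s.carrier k) : k) = s.op (pres a : k) (pres b : k))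
    (pres' : B' ≃ₜ s'.carrier k')
    (hadd' : ∀ a b : B', ((pres' (a + b) : s'.carrier k') : k') = s'.op (pres' a : k') (pres' b : k'))
    (φ : B →ₜ+ B') (hφ : ∀ b, s'.kummer c' (pres' (φ b) : k') = α (s.kummer c (pres b : k))) :
    Function.Surjective φ := by
  intro b'
  cases s <;> cases s'
  · -- times → times
    have hy : (pres' b' : k') ≠ 0 := (pres' b').2
    let x : THPlusShape.times.carrier k :=
      ⟨c.symm (α.symm (c' (pres' b' : k'))), by
        change c.symm (α.symm (c' (pres' b' : k'))) ≠ 0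
        simpa using hy⟩
    refine ⟨pres.symm x, pres'.injective (Subtype.ext ?_)⟩
    rw [presMap_eq_times_times c c' α φ pres pres' hφ x]
    change c'.symm (α (c (c.symm (α.symm (c' (pres' b' : k')))))) = _
    simp
  · exact (false_of_times_sim c c' α φ hk' pres hadd pres' hadd' hφ).elim
  · -- sim → times
    have hy : (pres' b' : k') ≠ 0 := (pres' b').2
    obtain ⟨w, hw⟩ := IsCAF.univCover_surjective_ne_zero hk' hy
    let x : THPlusShape.sim.carrier k := ⟨c.symm (α.symm (c' w)), Set.mem_univ _⟩
    refine ⟨pres.symm x, pres'.injective (Subtype.ext ?_)⟩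
    rw [presMap_eq_sim_times c c' α φ hk hc hα hc's pres pres' hφ x, ← hw]
    change univCover k' (c'.symm (α (c (c.symm (α.symm (c' w)))))) = _
    simp
  · -- sim → sim
    let x : THPlusShape.sim.carrier k := ⟨c.symm (α.symm (c' (pres' b' : k'))), Set.mem_univ _⟩
    refine ⟨pres.symm x, pres'.injective (Subtype.ext ?_)⟩
    rw [presMap_eq_sim_sim c c' α φ hk hk' hc hα hc's pres hadd pres' hadd' hφ x]
    change c'.symm (α (c (c.symm (α.symm (c' (pres' b' : k')))))) = _
    simp

/-- A Kummer-compatible continuous homomorphism is a HOLOMORPHIC LOCAL ISOMORPHISM in the charts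
`e ∘ α ∘ c` and `e ∘ c′` (coordinate expression: the identity, resp. `exp`). [cite: MochizukiAbsTopIII2015, Definition 4.1 (ii) p.102] -/
theorem isHolLocIso_of_compat_aux [CharZero k] [CharZero k'] (hk : IsCAF k) (hk' : IsCAF k')
    (s s' : THPlusShape) (c : k ≃+* A) (c' : k' ≃+* A') (α : A ≃+* A') (hc : Continuous c)
    (hcs : Continuous c.symm) (hα : Continuous α) (hαs : Continuous α.symm)
    (hc's : Continuous c'.symm) (pres : B ≃ₜ s.carrier k)
    (hadd : ∀ a b : B, ((pres (a + b) : s.carrier k) : k) = s.op (pres a : k) (pres b : k))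
    (pres' : B' ≃ₜ s'.carrier k')
    (hadd' : ∀ a b : B', ((pres' (a + b) : s'.carrier k') : k') = s'.op (pres' a : k') (pres' b : k'))
    (φ : B →ₜ+ B') (hφ : ∀ b, s'.kummer c' (pres' (φ b) : k') = α (s.kummer c (pres b : k)))
    (e : A' ≃+* ℂ) (he : Continuous e) (he' : Continuous e.symm) :
    IsHolLocIso (fun x => e (α (c x))) (fun y => e (c' y)) (s.carrier k)
      (fun x => (pres' (φ (pres.symm x)) : k')) := by
  -- the first chart is a homeomorphism `k → ℂ`
  let u : k ≃+* ℂ := c.trans (α.trans e)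
  have hu : Continuous u := he.comp (hα.comp hc)
  have hus : Continuous u.symm := hcs.comp (hαs.comp he')
  have hinj : Function.Injective (fun x => e (α (c x))) := u.injective
  have hopen : IsOpen ((fun x => e (α (c x))) '' s.carrier k) :=
    (ringEquivHomeomorph u hu hus).isOpenMap _ s.isOpen_carrier
  cases s <;> cases s'
  · refine IsHolLocIso.of_eq_id hinj hopen (fun x => ?_)
    rw [presMap_eq_times_times c c' α φ pres pres' hφ x, RingEquiv.apply_symm_apply]
  · exact (false_of_times_sim c c' α φ hk' pres hadd pres' hadd' hφ).elim
  · refine IsHolLocIso.of_eq_exp hinj hopen (fun x => ?_)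
    rw [presMap_eq_sim_times c c' α φ hk hc hα hc's pres pres' hφ x,
      IsCAF.univCover_eq (c'.trans e) (hc's.comp he')]
    change e (c' ((c'.trans e).symm (exp (e (c' (c'.symm (α (c x)))))))) = _
    rw [RingEquiv.apply_symm_apply]
    change e (c' (c'.symm (e.symm (exp (e (α (c x))))))) = _
    rw [RingEquiv.apply_symm_apply, RingEquiv.apply_symm_apply]
  · refine IsHolLocIso.of_eq_id hinj hopen (fun x => ?_)
    rw [presMap_eq_sim_sim c c' α φ hk hk' hc hα hc's pres hadd pres' hadd' hφ x, RingEquiv.apply_symm_apply]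

end Aux

/-! ### At the level of `𝒞^hol_{TH⊞}` -/

namespace HolTHPlusPair

variable {𝔄 : AutHolFieldFunctor.{u}}

/-- ★ **A Kummer-compatible continuous homomorphism of arithmetic data is ONTO** — the field `surj` of
`HolTHPlusPair.Hom` is a consequence of `compat`. [cite: MochizukiAbsTopIII2015, Definition 4.1 (ii) p.102] -/
theorem surjective_of_compat {P Q : HolTHPlusPair 𝔄} (f : P.X ⟶ Q.X) (φ : P.B →ₜ+ Q.B)
    (h : ∀ b, Q.κ (φ b) = 𝔄.Amap f (P.κ b)) : Function.Surjective φ :=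
  @surjective_of_compat_aux P.k Q.k (𝔄.A P.X) (𝔄.A Q.X) P.B Q.B _ _ _ _ _ _ _ _ P.charZero_k Q.charZero_k
    P.isCAF Q.isCAF P.shape Q.shape P.c Q.c (𝔄.Amap f) P.continuous_c (𝔄.continuous_Amap f)
    Q.continuous_c_symm P.pres P.pres_add Q.pres Q.pres_add φ (fun b => (Q.κ_def _).symm.trans
      ((h b).trans (congrArg _ (P.κ_def _))))

/-- ★ **A Kummer-compatible continuous homomorphism is a morphism of Aut-holomorphic spaces** (holomorphic
local isomorphism in the Kummer charts) — the field `hol` of `HolTHPlusPair.Hom` is a consequence of `compat`.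
[cite: MochizukiAbsTopIII2015, Definition 4.1 (ii) p.102] -/
theorem isHolLocIso_of_compat {P Q : HolTHPlusPair 𝔄} (f : P.X ⟶ Q.X) (φ : P.B →ₜ+ Q.B)
    (h : ∀ b, Q.κ (φ b) = 𝔄.Amap f (P.κ b)) (e : 𝔄.A Q.X ≃+* ℂ) (he : Continuous e)
    (he' : Continuous e.symm) :
    IsHolLocIso (P.toTHPair.chart f e) (Q.toTHPair.chart (𝟙 Q.X) e) (P.shape.carrier P.k) (presMap P Q φ) := by
  have hu : Q.toTHPair.chart (𝟙 Q.X) e = fun y => e (Q.c y) := by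
    funext y
    change e (𝔄.Amap (𝟙 Q.X) (Q.c y)) = e (Q.c y)
    rw [𝔄.Amap_id_apply]
  rw [hu]
  exact @isHolLocIso_of_compat_aux P.k Q.k (𝔄.A P.X) (𝔄.A Q.X) P.B Q.B _ _ _ _ _ _ _ _ P.charZero_k
    Q.charZero_k P.isCAF Q.isCAF P.shape Q.shape P.c Q.c (𝔄.Amap f) P.continuous_c P.continuous_c_symm
    (𝔄.continuous_Amap f) (𝔄.continuous_Amap_symm f) Q.continuous_c_symm P.pres P.pres_add
    Q.pres Q.pres_add φ (fun b => (Q.κ_def _).symm.trans ((h b).trans (congrArg _ (P.κ_def _)))) e he he'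

/-- **A morphism of `𝒞^hol_{TH⊞}` from `(φ_𝕏, φ_M, compat)` alone**: its arithmetic part is `φ_M`.
[cite: MochizukiAbsTopIII2015, Definition 4.1 (ii) p.102] -/
theorem Hom.ofCompat_arith {P Q : HolTHPlusPair 𝔄} (f : P.X ⟶ Q.X) (φ : P.B →ₜ+ Q.B)
    (h : ∀ b, Q.κ (φ b) = 𝔄.Amap f (P.κ b)) :
    (⟨f, φ, surjective_of_compat f φ h, h, isHolLocIso_of_compat f φ h⟩ : P ⟶ Q).arith = φ := rfl

end HolTHPlusPair

end Literature.AnabelianGeometry.AbsoluteAnabelian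

end
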